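import Summits.ResolutionOfSingularities.ResolutionOfSingularities.Theorems.PurelyInseparableDim4ResConeTwoSlotPowerConeTailSigma
import Summits.ResolutionOfSingularities.ResolutionOfSingularities.Theorems.PurelyInseparableDim4ResConeSupportConfinedRank
import Summits.ResolutionOfSingularities.ResolutionOfSingularities.Theorems.PurelyInseparableDim4ResConePowerChain
import Summits.ResolutionOfSingularities.ResolutionOfSingularities.Theorems.PurelyInseparableDim4FreeTailLemma
import Summits.ResolutionOfSingularities.ResolutionOfSingularities.Theorems.PurelyInseparableDim4BandShade
import HarnessLib
import HarnessLib.Audit.Tags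

/-!
# Purely inseparable four-folds — POWER-CONE TAILS, CLASS (i) FROM THE RAW CHAIN: a T-sector power-cone tail with σ-weights
# (n, n) + w at every late time (w ≥ 1, w ≠ n) is impossible — every prime (cell `res-dim4-pi`, K2(p) lane, B rows, row B-LF (iii-b)
# «K24a-PRIME-σ», the RAW → class-(i) link; seat res-dim4-p-1 g6)

[OURS · counted 0 · cell `res-dim4-pi` · K2(p) lane (holder res-dim4-p-12 g5, rulings g5-17/18/20).  LINK ONLY — the kill is res-dim4-p-7 g6's
composition `ResCone.no_twoSlot_powerCone_tail_classI_sigma` (transport res-dim4-typ-1 g5 T1/T2′, entry res-dim4-p-1 g6 E1, game δ1–δ3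
res-dim4-p-7 g6 / res-dim4-p-9 g5), CITED BY NAME.]  Nothing here proves K2(p) for any `p`, any TAIL(p, d, 3), `NoAboveFloorTrap p p` or
resolution of singularities in dimension ≥ 4 / characteristic `p` — NOT proved.  AI kernel work, weaker than expert review.

WHAT THIS FILE ADDS (chain-level bookkeeping, no new mathematics).  p-7's theorem wants a tail ALREADY in T-normal form: slot charts only,
the carrier `z` never charted and NOT EXCEPTIONAL at the start, σ-weights `n·x + n·y + w·v` on FIXED letters, a clean start, a straightened
form datum and a letter change at time `0`.  From the lane's RAW package (an isolated above-floor witnessed `Step0 p` chain with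
`x^{r₀} ∣ F₀`, shade `d` and `e_G = 3` from `k₀`, polar kernels `ℓ k`) plus «σ-weights for SOME three letters at every `k ≥ k₀`» and the
T-sector witness «at a late time `kₑ` a weight-0 letter `φ` carries the form» we supply all of it:
* §1 **the boundary set `exc` is free bookkeeping**: `CentreBlowup.step` reads `exc` only to produce the new `exc`, so every witnessed
  chain has a twin with the SAME `F`, `r`, charts and points and EMPTY initial `exc` (`exists_reexc_chain`, the `exc`-edition of
  `BandShade.exists_rezero_chain`); above the floor «`exc ⊆ supp r`» then holds at every time (`exc_subset_of_reexc`: the new weight is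
  `o − p ≥ 1`, translated letters leave `exc`) — so a weight-0 letter is never exceptional, which discharges T2′'s `hez` with NO hypothesis;
* §2 σ-weights are transported by letter permutations (`sigma_mapDomain_perm`), and along a chain whose charts avoid `z` the σ-weights sit on
  FIXED letters and the charts are slots (`sigma_slots_of_chain`, T1 `SwapTransport.step_cases_of_weights_sigma` by induction; `w ≠ n`);
* §3 **`no_powerCone_tail_classI_sigma_raw`**: partner chain of `ResCone.powerCone_freeCarrier_representation` (φ never charted), §1 twin,
  §2 letters, a satellite (= letter-change) time `t₀ ≥ 1` by the free-tail lemma (`FreeTailProof.noIsolatedFreeTailAt_self`), the power-cone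
  form there (`ResCone.chain_resForm_eq_C_mul_pow`, `ℓ z ≠ 0` from the partner's kernel clause), shift by `t₀`, p-7's theorem.
The diagonal `w = n` (three weight-`n` letters) is NOT covered: there the weights do not pin the charts (bus 2026-08-29 13:13Z).
[cite: CossartJannsenSaito2020, Thm. 3.14] [cite: Hauser2010, §§F–G (chart expressions of a point blowup; transform D′; cleaning)]
[cite: HauserPerlega2019PRIMS, §2 (transform D′ of D)]
bears_on: LADDER-RESOLUTION:D157-DOOR2 (res-dim4-pi · K2(p) B-LF (iii-b) K24a-PRIME-σ class (i) RAW link).  Supports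
stmt-ResolutionOfSingularities-16155 (helper).
-/

set_option linter.dupNamespace false -- mandated namespace of this single-conjunct summit

noncomputable section

namespace Summit.ResolutionOfSingularities.ResolutionOfSingularities.Theorems.PIDim4

namespace ResCone

open MvPolynomial Finset
open Literature.AlgebraicGeometry.Resolution
open Literature.AlgebraicGeometry.Resolution.CentreBlowup
open Literature.AlgebraicGeometry.Resolution.Hauser2010
open Literature.AlgebraicGeometry.Resolution.HauserPerlega2019

variable {K : Type} [Field K] [DecidableEq K]

/-! ## §1 The boundary set is free bookkeeping -/

/-- The multiplicities of a step depend on the parent only through `F` and `r`. [folklore] [cite: Hauser2010, §F (transform D′)] -/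
theorem step_r_congr {q : ℕ} {S : Finset (Fin 4)} {j : Fin 4} {b : Fin 4 → K} {s t : State K} (hF : s.F = t.F)
    (hr : s.r = t.r) : (CentreBlowup.step q S j b s).r = (CentreBlowup.step q S j b t).r := by
  show newMult q S j b s = newMult q S j b t
  unfold newMult
  rw [hF, hr]

/-- **Re-running a witnessed chain on the empty boundary**: same polynomials, multiplicities, charts and points, `exc₀ = ∅`.
[OURS · frame bookkeeping] [folklore] -/
theorem exists_reexc_chain {q : ℕ} {c : ℕ → State K} {j : ℕ → Fin 4} {b : ℕ → Fin 4 → K}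
    (hw : FreeTail.IsWitnessedChain q c j b) :
    ∃ c' : ℕ → State K, FreeTail.IsWitnessedChain q c' j b ∧ (∀ k, (c' k).F = (c k).F ∧ (c' k).r = (c k).r) ∧
      (c' 0).exc = ∅ := by
  let c' : ℕ → State K := fun k =>
    Nat.rec (⟨(c 0).F, (c 0).r, ∅⟩ : State K) (fun k s => CentreBlowup.step q Finset.univ (j k) (b k) s) k
  have hc'0 : c' 0 = ⟨(c 0).F, (c 0).r, ∅⟩ := rfl
  have hc's : ∀ k, c' (k + 1) = CentreBlowup.step q Finset.univ (j k) (b k) (c' k) := fun k => rfl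
  have hFr : ∀ k, (c' k).F = (c k).F ∧ (c' k).r = (c k).r := by
    intro k
    induction k with
    | zero => exact ⟨rfl, rfl⟩
    | succ k ih =>
      obtain ⟨-, -, -, -, hstep⟩ := hw k
      rw [hc's, hstep]
      exact ⟨BandShade.step_F_congr ih.1, step_r_congr ih.1 ih.2⟩
  refine ⟨c', fun k => ?_, hFr, by rw [hc'0]⟩
  obtain ⟨hq, hbj, heq, hne, hstep⟩ := hw k
  refine ⟨by rw [(hFr k).1]; exact hq, hbj, (BandShade.isEquimultiplePoint_congr (hFr k).1).mpr heq, ?_, hc's k⟩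
  rw [BandShade.step_F_congr (hFr k).1]
  exact hne

/-- **Above the floor the boundary set stays inside the support of the multiplicities**: the new component gets weight `o − q ≥ 1`, a
translated letter leaves `exc`, the others keep weight and membership. [OURS · frame bookkeeping] [cite: Hauser2010, §F (transform D′)] -/
theorem exc_subset_rsupport {q : ℕ} {c : ℕ → State K} {j : ℕ → Fin 4} {b : ℕ → Fin 4 → K}
    (hw : FreeTail.IsWitnessedChain q c j b) (hband : ∀ k, ∃ o : ℕ, ordZero (c k).F = o ∧ q < o)
    (h0 : ∀ i ∈ (c 0).exc, (c 0).r i ≠ 0) : ∀ k, ∀ i ∈ (c k).exc, (c k).r i ≠ 0 := by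
  intro k
  induction k with
  | zero => exact h0
  | succ k ih =>
    intro i hi
    obtain ⟨-, -, -, -, hstep⟩ := hw k
    obtain ⟨o, ho, hqo⟩ := hband k
    rw [hstep] at hi ⊢
    rw [SwapTransport.step_r_apply_gen q ho]
    change i ∈ newExc (j k) (b k) (c k) at hi
    unfold newExc at hi
    rw [Finset.mem_insert, Finset.mem_filter] at hi
    by_cases hij : i = j k
    · rw [if_pos hij]; omega
    · rw [if_neg hij]
      rcases hi with h | ⟨hiE, hb0⟩
      · exact absurd h hij
      · rw [if_pos hb0]; exact ih i hiE

/-! ## §2 σ-weights under letter permutations; slots along a chain avoiding the carrier -/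

omit [DecidableEq K] in
/-- σ-weights are transported by a letter permutation. [folklore] -/
theorem sigma_mapDomain_perm {n w : ℕ} {a a' u : Fin 4} (haa' : a ≠ a') (hau : a ≠ u) (ha'u : a' ≠ u) (π : Equiv.Perm (Fin 4))
    {r : Fin 4 →₀ ℕ} (hr : r = Finsupp.single a n + Finsupp.single a' n + Finsupp.single u w) :
    ∃ x y v : Fin 4, x ≠ y ∧ x ≠ v ∧ y ≠ v ∧
      Finsupp.mapDomain (Equiv.symm π) r = Finsupp.single x n + Finsupp.single y n + Finsupp.single v w := by
  refine ⟨π.symm a, π.symm a', π.symm u, fun h => haa' (π.symm.injective h), fun h => hau (π.symm.injective h),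
    fun h => ha'u (π.symm.injective h), ?_⟩
  rw [hr, Finsupp.mapDomain_add, Finsupp.mapDomain_add, Finsupp.mapDomain_single, Finsupp.mapDomain_single,
    Finsupp.mapDomain_single]

/-- Values of σ-weights at the three letters and at the fourth. [folklore] -/
theorem sigma_apply {n w : ℕ} {x y v z : Fin 4} (hxy : x ≠ y) (hxv : x ≠ v) (hxz : x ≠ z) (hyv : y ≠ v) (hyz : y ≠ z)
    (hvz : v ≠ z) :
    (Finsupp.single x n + Finsupp.single y n + Finsupp.single v w : Fin 4 →₀ ℕ) x = n ∧
      (Finsupp.single x n + Finsupp.single y n + Finsupp.single v w : Fin 4 →₀ ℕ) y = n ∧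
      (Finsupp.single x n + Finsupp.single y n + Finsupp.single v w : Fin 4 →₀ ℕ) v = w ∧
      (Finsupp.single x n + Finsupp.single y n + Finsupp.single v w : Fin 4 →₀ ℕ) z = 0 :=
  SwapTransport.sigma_weights_values hxy hxv hxz hyv hyz hvz n w

/-- **Along a witnessed chain whose charts avoid `z`, with order `p + n` and σ-weights for SOME three letters at every time, the
σ-weights of time `0` sit on the SAME letters for ever and every chart is a slot** (`w ≠ n`; T1 by induction). [OURS]
[cite: Hauser2010, §F (transform D′)] -/
theorem sigma_slots_of_chain (p : ℕ) {n w : ℕ} (hn : 0 < n) (hw : 0 < w) (hwn : w ≠ n) {x y v z : Fin 4} (hxy : x ≠ y)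
    (hxv : x ≠ v) (hxz : x ≠ z) (hyv : y ≠ v) (hyz : y ≠ z) (hvz : v ≠ z) {c : ℕ → State K} {j : ℕ → Fin 4}
    {b : ℕ → Fin 4 → K} (hwit : FreeTail.IsWitnessedChain p c j b) (hjz : ∀ k, j k ≠ z)
    (hr0 : (c 0).r = Finsupp.single x n + Finsupp.single y n + Finsupp.single v w)
    (hσtail : ∀ k, ∃ x' y' v' : Fin 4, x' ≠ y' ∧ x' ≠ v' ∧ y' ≠ v' ∧
      (c k).r = Finsupp.single x' n + Finsupp.single y' n + Finsupp.single v' w)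
    (ho : ∀ k, ordZero (c k).F = ((p + n : ℕ) : ℕ∞)) :
    ∀ k, (c k).r = Finsupp.single x n + Finsupp.single y n + Finsupp.single v w ∧ (j k = x ∨ j k = y) := by
  have hstep : ∀ k, c (k + 1) = CentreBlowup.step p Finset.univ (j k) (b k) (c k) := fun k => (hwit k).2.2.2.2
  have hbj : ∀ k, b k (j k) = 0 := fun k => (hwit k).2.1
  have hr : ∀ k, (c k).r = Finsupp.single x n + Finsupp.single y n + Finsupp.single v w := by
    intro k
    induction k with
    | zero => exact hr0
    | succ k ih =>
      obtain ⟨x', y', v', h1, h2, h3, hr'⟩ := hσtail (k + 1)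
      rw [hstep k] at hr' ⊢
      exact (SwapTransport.step_cases_of_weights_sigma p hn hw hwn hxy hxv hxz hyv hyz hvz ih (ho k) (hjz k) (hbj k)
        ⟨x', y', v', h1, h2, h3, hr'⟩).2.2.trans ih
  intro k
  obtain ⟨x', y', v', h1, h2, h3, hr'⟩ := hσtail (k + 1)
  rw [hstep k] at hr'
  exact ⟨hr k, (SwapTransport.step_cases_of_weights_sigma p hn hw hwn hxy hxv hxz hyv hyz hvz (hr k) (ho k) (hjz k) (hbj k)
    ⟨x', y', v', h1, h2, h3, hr'⟩).1⟩

/-! ## §3 Class (i) from the raw chain -/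

/-- **NO T-SECTOR POWER-CONE TAIL WITH σ-WEIGHTS (n, n) + w, `w ≥ 1`, `w ≠ n` — every prime** (module docstring): the lane's RAW package +
σ-weights for SOME three letters at every late time + a late weight-0 form-carrying letter ⊢ `False`.  LINK: partner of
`powerCone_freeCarrier_representation`, boundary twin (§1), fixed letters and slots (§2), a satellite time (free-tail lemma), the
power-cone form there, res-dim4-p-7 g6's `no_twoSlot_powerCone_tail_classI_sigma`. [OURS · link · every mathematical step cited by name]
[cite: CossartJannsenSaito2020, Thm. 3.14] [cite: Hauser2010, §§F–G] [cite: HauserPerlega2019PRIMS, §2 (transform D′ of D)] -/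
theorem no_powerCone_tail_classI_sigma_raw (p : ℕ) [Fact p.Prime] [CharP K p] {n w d : ℕ} (hσ : n + w + d = p) (hn : 0 < n)
    (hw : 0 < w) (hwn : w ≠ n) (hd2 : 2 ≤ d) {c : ℕ → State K} {j : ℕ → Fin 4} {b : ℕ → Fin 4 → K}
    (hc : ∀ k, IsIsolated p (c k).F ∧ Step0 p (c k) (c (k + 1))) (hwit : FreeTail.IsWitnessedChain p c j b)
    (hr0 : ∀ e ∈ (c 0).F.support, (c 0).r ≤ e) (hfloor : ∀ k, ordZero (c k).F ≠ p) {k₀ : ℕ}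
    (hshade : ∀ k, k₀ ≤ k → (c k).shade = (d : ℕ∞)) (he3 : ∀ k, k₀ ≤ k → Module.finrank K (resVertex (c k)) = 3)
    (hσtail : ∀ k, k₀ ≤ k → ∃ x y v : Fin 4, x ≠ y ∧ x ≠ v ∧ y ≠ v ∧
      (c k).r = Finsupp.single x n + Finsupp.single y n + Finsupp.single v w)
    {ℓ : ℕ → Fin 4 → K} (hℓV : ∀ k, k₀ ≤ k → ∀ u, u ∈ resVertex (c k) ↔ dotProduct (ℓ k) u = 0)
    {kₑ : ℕ} (hke : k₀ + 1 ≤ kₑ) {φ : Fin 4} (hrφ : (c kₑ).r φ = 0) (hℓφ : ℓ kₑ φ ≠ 0) : False := by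
  classical
  have hdp : d < p := by omega
  have hd1 : 1 ≤ d := by omega
  -- (1) the partner: `φ` never charted, weight `0` for ever, carrying the form; weights = permutation images
  obtain ⟨c₁, j₁, b₁, hc₁0, hperm, hrφ₁, hjφ, hker, hc₁, hw₁, hr0₁, hfloor₁, hshade₁, he3₁⟩ :=
    powerCone_freeCarrier_representation p hc hwit hr0 hfloor hshade he3 hℓV hke hrφ hℓφ
  -- (2) the boundary twin of the partner: same `F`, `r`, charts, points; `exc₀ = ∅`
  obtain ⟨c', hw', hFr, hexc0⟩ := exists_reexc_chain hw₁
  have hF' : ∀ t, (c' t).F = (c₁ t).F := fun t => (hFr t).1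
  have hr' : ∀ t, (c' t).r = (c₁ t).r := fun t => (hFr t).2
  have hstep' : ∀ t, c' (t + 1) = CentreBlowup.step p Finset.univ (j₁ t) (b₁ t) (c' t) := fun t => (hw' t).2.2.2.2
  have hiso' : ∀ t, IsIsolated p (c' t).F := fun t => by rw [hF']; exact (hc₁ t).1
  have hc' : ∀ t, IsIsolated p (c' t).F ∧ Step0 p (c' t) (c' (t + 1)) := fun t => by
    obtain ⟨hq, hbj, heq, hne, hst⟩ := hw' t
    exact ⟨hiso' t, hq, j₁ t, b₁ t, Finset.mem_univ _, hbj, heq, hne, hst⟩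
  have hfloor' : ∀ t, ordZero (c' t).F ≠ p := fun t => by rw [hF']; exact hfloor₁ t
  have hshade' : ∀ t, 0 ≤ t → (c' t).shade = (d : ℕ∞) := fun t ht => by
    have h := hshade₁ t ht
    unfold CState.shade at h ⊢
    rw [hF', hr']; exact h
  have hresV' : ∀ t, resVertex (c' t) = resVertex (c₁ t) := fun t => by
    unfold resVertex resForm
    rw [hF', hr']
  have he3' : ∀ t, 0 ≤ t → Module.finrank K (resVertex (c' t)) = 3 := fun t ht => by rw [hresV']; exact he3₁ t ht
  have hdiv' : ∀ t, ∀ e ∈ (c' t).F.support, (c' t).r ≤ e := by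
    intro t
    induction t with
    | zero => rw [hF', hr']; exact hr0₁
    | succ t ih => rw [hstep' t]; exact SwapTransport.forall_le_step_gen (c' t) ih (j₁ t) (hw' t).2.1
  have hband' : ∀ t, ∃ o : ℕ, ordZero (c' t).F = o ∧ p < o := fun t => by
    obtain ⟨o, ho, hpo, -⟩ := chain_band p hc' hfloor' t
    exact ⟨o, ho, hpo⟩
  -- order `p + n` and the values of the weights
  have hdeg : ∀ t, (c' t).r.degree = 2 * n + w := fun t => by
    obtain ⟨π, hπ⟩ := hperm t
    obtain ⟨a, a', u, h1, h2, h3, hr⟩ := hσtail (kₑ + t) (by omega)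
    obtain ⟨x, y, v, -, -, -, hσ'⟩ := sigma_mapDomain_perm h1 h2 h3 π hr
    rw [hr', hπ, hσ', map_add, map_add, Finsupp.degree_single, Finsupp.degree_single, Finsupp.degree_single]
    omega
  have ho' : ∀ t, ordZero (c' t).F = ((p + n : ℕ) : ℕ∞) := fun t => by
    obtain ⟨o, ho, hpo⟩ := hband' t
    have hsh := hshade' t (Nat.zero_le _)
    rw [BandShade.shade_eq_coe ho, hdeg, Nat.cast_inj] at hsh
    rw [ho]; congr 1; omega
  -- (3) `φ` is never exceptional on the twin
  have hexc : ∀ t, ∀ i ∈ (c' t).exc, (c' t).r i ≠ 0 :=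
    exc_subset_rsupport hw' hband' (by rw [hexc0]; simp)
  have hφexc : ∀ t, φ ∉ (c' t).exc := fun t h => hexc t φ h (by rw [hr']; exact hrφ₁ t)
  -- (4) the letters: σ-weights of the twin at time `0` on letters `x, y, v ≠ φ`
  obtain ⟨π₀, hπ₀⟩ := hperm 0
  obtain ⟨a, a', u, h1, h2, h3, hra⟩ := hσtail (kₑ + 0) (by omega)
  obtain ⟨x, y, v, hxy, hxv, hyv, hσ0⟩ := sigma_mapDomain_perm h1 h2 h3 π₀ hra
  have hr'0 : (c' 0).r = Finsupp.single x n + Finsupp.single y n + Finsupp.single v w := by rw [hr', hπ₀, hσ0]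
  have hφ0 : (c' 0).r φ = 0 := by rw [hr']; exact hrφ₁ 0
  have hxz : x ≠ φ := fun h => by
    have := congrArg (fun r : Fin 4 →₀ ℕ => r x) hr'0
    simp only [Finsupp.add_apply, Finsupp.single_eq_same, Finsupp.single_eq_of_ne hxy, Finsupp.single_eq_of_ne hxv] at this
    rw [h, hφ0] at this; omega
  have hyz : y ≠ φ := fun h => by
    have := congrArg (fun r : Fin 4 →₀ ℕ => r y) hr'0
    simp only [Finsupp.add_apply, Finsupp.single_eq_same, Finsupp.single_eq_of_ne hxy.symm, Finsupp.single_eq_of_ne hyv] at this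
    rw [h, hφ0] at this; omega
  have hvz : v ≠ φ := fun h => by
    have := congrArg (fun r : Fin 4 →₀ ℕ => r v) hr'0
    simp only [Finsupp.add_apply, Finsupp.single_eq_same, Finsupp.single_eq_of_ne hxv.symm, Finsupp.single_eq_of_ne hyv.symm] at this
    rw [h, hφ0] at this; omega
  have hσtail' : ∀ t, ∃ x' y' v' : Fin 4, x' ≠ y' ∧ x' ≠ v' ∧ y' ≠ v' ∧
      (c' t).r = Finsupp.single x' n + Finsupp.single y' n + Finsupp.single v' w := fun t => by
    obtain ⟨π, hπ⟩ := hperm t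
    obtain ⟨a₁, a₁', u₁, h1, h2, h3, hr⟩ := hσtail (kₑ + t) (by omega)
    obtain ⟨x', y', v', h1', h2', h3', hσ'⟩ := sigma_mapDomain_perm h1 h2 h3 π hr
    exact ⟨x', y', v', h1', h2', h3', by rw [hr', hπ, hσ']⟩
  have hslots := sigma_slots_of_chain p hn hw hwn hxy hxv hxz hyv hyz hvz hw' hjφ hr'0 hσtail' ho'
  -- (5) a satellite (letter-change) time `t₀ ≥ 1`
  obtain ⟨t₀, ht₀, hsat⟩ := (FreeTail.satelliteRecurrenceAt_iff_noIsolatedFreeTailAt p p).mpr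
    (FreeTailProof.noIsolatedFreeTailAt_self p) K c' j₁ b₁ hw' hiso' 1
  -- (6) the power-cone form at `t₀`, carried by `φ`
  obtain ⟨ℓ₀, a₀, -, hℓ₀V, hform⟩ := chain_resForm_eq_C_mul_pow p hc' hfloor' hdp hshade' he3' (Nat.zero_le t₀)
  have ha₀ : a₀ ≠ 0 := by
    intro h
    obtain ⟨o, ho, -⟩ := hband' t₀
    apply resForm_ne_zero ho (hdiv' t₀)
    rw [hform, h, C_0, zero_mul]
  have hℓ₀φ : ℓ₀ φ ≠ 0 := by
    intro h
    have hmem : (Pi.single φ (1 : K) : Fin 4 → K) ∈ resVertex (c' t₀) := by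
      rw [hℓ₀V, dotProduct_single, mul_one, h]
    have hzero := hker t₀ _ (by rw [← hresV']; exact hmem) fun i hi => by
      rw [Finset.mem_erase] at hi
      exact Pi.single_eq_of_ne hi.1 _
    have := congrFun hzero φ
    rw [Pi.single_eq_same, Pi.zero_apply] at this
    exact one_ne_zero this
  -- (7) shift by `t₀` and close with the class-(i) composition
  have hclean : deletePthPowers p (c' t₀).F = (c' t₀).F := by
    obtain ⟨t, rfl⟩ : ∃ t, t₀ = t + 1 := ⟨t₀ - 1, by omega⟩
    rw [hstep' t]
    exact CentreBlowup.deletePthPowers_step p Finset.univ (j₁ t) (b₁ t) (c' t)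
  have hwit'' : FreeTail.IsWitnessedChain p (fun k => c' (t₀ + k)) (fun k => j₁ (t₀ + k)) fun k => b₁ (t₀ + k) :=
    fun k => hw' (t₀ + k)
  exact no_twoSlot_powerCone_tail_classI_sigma p hσ hn hw hd2 hxy hxv hxz hyv hyz hvz hwit'' hclean
    (fun k => (hslots (t₀ + k)).2) (hφexc t₀) (hslots (t₀ + 0)).1 (fun k => hσtail' (t₀ + k)) (fun k => ho' (t₀ + k))
    (hdiv' (t₀ + 0)) (fun k => he3' (t₀ + k) (Nat.zero_le _)) (fun k => hiso' (t₀ + k)) ha₀ hℓ₀φ hform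
    (by simpa [Nat.add_zero] using hsat.1.symm)

end ResCone

end Summit.ResolutionOfSingularities.ResolutionOfSingularities.Theorems.PIDim4

end
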